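import Literature.NumberTheory.Automorphic.IntegratedOperator
import Literature.NumberTheory.Automorphic.DiscreteDecompositionCriterion
import Mathlib.Topology.UrysohnsLemma
import HarnessLib

/-!
# Discrete decomposability from compact integrated operators (the combined criterion)

One-line combination of `ClosedSubrep.exists_isCompactOperator_family_integrated`
(`IntegratedOperator`: the operators `π(f)|_W`, `f` running through a Dirac-rich family
`𝓕 ⊆ C_c(G)` with `π(f)|_W` compact, are compact, preserve closed invariant subspaces of `W` and
are non-degenerate on each non-zero one) with the abstract criterion
`IsUnitary.isDiscretelyDecomposable_of_isCompactOperator` (`DiscreteDecompositionCriterion`,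
Getz–Hahn (2024), Lemma 9.3.1) applied to the unitary representation `W.toContRep`:

* `ClosedSubrep.isDiscretelyDecomposable_toContRep_of_isCompactOperator_integrated`
  (Deitmar–Echterhoff (2014), Lemma 9.2.7 with the remark on Dirac nets; Getz–Hahn (2024),
  Lemma 9.3.1): under these hypotheses `W` is the closed span of its topologically irreducible
  closed invariant subspaces (`IsDiscretelyDecomposable`);
* `Literature.NumberTheory.Automorphic.exists_dirac_function` (Deitmar–Echterhoff (2014), §1.6,
  Lemma 1.6.5): on a locally compact Hausdorff group with a measure finite on compacts and
  positive on opens (a Haar measure), every neighbourhood of `1` supports a real non-negative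
  `f ∈ C_c(G)` with `∫ f > 0` (Urysohn), so that `𝓕 = C_c(G)` is Dirac-rich;
* `ClosedSubrep.isDiscretelyDecomposable_toContRep_of_forall_isCompactOperator`: hence, on such
  a group, compactness of `π(f)|_W` for *every* `f ∈ C_c(G)` already gives the discrete
  decomposition of `W`.

This is the form consumed by the decomposition of the Gelfand–Piatetski-Shapiro discreteness fact
`GLnCuspidalSpectrum.isDiscretelyDecomposable_cuspidal` / `AutomorphicGLn.…` (`W = L²_cusp`,
`π = rightRegular`, `𝓕 =` smooth compactly supported functions on `GL_n(𝔸_K)`, compactness by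
Getz–Hahn Thm. 9.1.1).

## References

* A. Deitmar, S. Echterhoff, *Principles of harmonic analysis*, 2nd ed. (2014), Lemma 9.2.7.
* J. R. Getz, H. Hahn, *An introduction to automorphic representations* (2024), Lemma 9.3.1.
-/

noncomputable section

open MeasureTheory Filter Topology CompactlySupported

namespace Literature.NumberTheory.Automorphic

/-- **Dirac functions exist** (Deitmar–Echterhoff (2014), §1.6, Lemma 1.6.5: every unit
neighbourhood supports a Dirac function). For a locally compact Hausdorff group `G`, a measure
`η` finite on compact sets and positive on non-empty open sets (a Haar measure), and a
neighbourhood `U` of `1`, there is `f ∈ C_c(G)`, real-valued and non-negative, supported in `U`,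
with `∫ f dη > 0` (Urysohn's lemma for locally compact regular spaces, Mathlib
`exists_continuous_one_zero_of_isCompact`; normalisation `∫ f = 1` and symmetry are not needed
below and not asserted). [cite: DeitmarEchterhoff2014, Lemma 1.6.5] -/
theorem exists_dirac_function {G : Type*} [Group G] [TopologicalSpace G] [IsTopologicalGroup G]
    [T2Space G] [LocallyCompactSpace G] [MeasurableSpace G] [OpensMeasurableSpace G]
    (η : Measure G) [IsFiniteMeasureOnCompacts η] [η.IsOpenPosMeasure] {U : Set G}
    (hU : U ∈ 𝓝 (1 : G)) :
    ∃ f : C_c(G, ℂ), (∀ g, 0 ≤ (f g).re ∧ (f g).im = 0) ∧ tsupport f ⊆ U ∧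
      0 < ∫ g, (f g).re ∂η := by
  -- a closed neighbourhood `C ⊆ U` of `1` and its interior `V`
  obtain ⟨C, ⟨hC1, hCc⟩, hCU⟩ := (closed_nhds_basis (1 : G)).mem_iff.mp hU
  set V : Set G := interior C with hV
  have hV1 : (1 : G) ∈ V := mem_interior_iff_mem_nhds.mpr hC1
  -- Urysohn: `φ = 1` at `1`, `φ = 0` off `V`, compactly supported, values in `[0, 1]`
  obtain ⟨φ, hφ1, hφ0, hφc, hφ01⟩ := exists_continuous_one_zero_of_isCompact
    (isCompact_singleton (x := (1 : G))) isOpen_interior.isClosed_compl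
    (Set.disjoint_singleton_left.mpr fun h => h hV1)
  have hφsupp : Function.support φ ⊆ V := by
    intro g hg
    by_contra hgV
    exact hg (hφ0 hgV)
  have hφtsupp : tsupport φ ⊆ U :=
    ((closure_mono hφsupp).trans (closure_minimal interior_subset hCc)).trans hCU
  -- the complex-valued version
  let F : C_c(G, ℂ) :=
    ⟨⟨fun g => (φ g : ℂ), Complex.continuous_ofReal.comp φ.continuous⟩,
      hφc.comp_left Complex.ofReal_zero⟩
  have hF : ∀ g, F g = (φ g : ℂ) := fun _ => rfl
  refine ⟨F, fun g => ?_, ?_, ?_⟩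
  · rw [hF, Complex.ofReal_re, Complex.ofReal_im]
    exact ⟨(hφ01 g).1, rfl⟩
  · have hsupp : Function.support F = Function.support φ := by
      ext g
      rw [Function.mem_support, Function.mem_support, hF, Ne, Complex.ofReal_eq_zero]
    change closure (Function.support F) ⊆ U
    rw [hsupp]
    exact hφtsupp
  · simp_rw [hF, Complex.ofReal_re]
    exact φ.continuous.integral_pos_of_hasCompactSupport_nonneg_nonzero hφc
      (fun g => (hφ01 g).1) (x := 1) (by rw [hφ1 rfl]; exact one_ne_zero)

end Literature.NumberTheory.Automorphic

open Literature.NumberTheory.Automorphic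


namespace ContRepresentation.ClosedSubrep

variable {G H : Type*} [Group G] [TopologicalSpace G] [MeasurableSpace G] [OpensMeasurableSpace G]
  [NormedAddCommGroup H] [InnerProductSpace ℂ H] [CompleteSpace H]
  {π : ContRepresentation ℂ G H}

/-- **Discreteness criterion via integrated operators** (Deitmar–Echterhoff (2014), Lemma 9.2.7;
Getz–Hahn (2024), Lemma 9.3.1). Let `π` be a unitary, strongly continuous representation of `G`
on a complex Hilbert space, `η` a measure on `G` finite on compact sets, `W` a closed invariant
subspace and `𝓕 ⊆ C_c(G)` a family containing, for every neighbourhood `U` of `1`, a real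
non-negative function supported in `U` of positive integral, such that `π(f)|_W` is compact for
every `f ∈ 𝓕`. Then the representation on `W` is discretely decomposable: `W` is the closed span
of its topologically irreducible closed invariant subspaces. [cite: DeitmarEchterhoff2014, Lemma 9.2.7] -/
theorem isDiscretelyDecomposable_toContRep_of_isCompactOperator_integrated (hu : π.IsUnitary)
    (hc : π.IsStronglyContinuous) (η : Measure G) [IsFiniteMeasureOnCompacts η]
    (W : ClosedSubrep π) (𝓕 : Set C_c(G, ℂ))
    (h_dirac : ∀ U ∈ 𝓝 (1 : G), ∃ f ∈ 𝓕, (∀ g, 0 ≤ (f g).re ∧ (f g).im = 0) ∧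
      tsupport f ⊆ U ∧ 0 < ∫ g, (f g).re ∂η)
    (h_compact : ∀ f ∈ 𝓕, IsCompactOperator fun w : W.toSubmodule =>
      π.integratedOperator hu hc η f (w : H)) :
    W.toContRep.IsDiscretelyDecomposable := by
  obtain ⟨𝒯, h₁, h₂, h₃⟩ :=
    W.exists_isCompactOperator_family_integrated hu hc η 𝓕 h_dirac h_compact
  exact (hu.toContRep W).isDiscretelyDecomposable_of_isCompactOperator 𝒯 h₁ h₂ h₃

/-- **Discreteness from compactness of all `π(f)`, `f ∈ C_c(G)`** (Deitmar–Echterhoff (2014),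
Lemma 9.2.7 with `A = C_c(G)`, which contains a Dirac net; Getz–Hahn (2024), Lemma 9.3.1). On a
locally compact Hausdorff group with a Haar-like measure `η` (finite on compacts, positive on
opens), if `π` is unitary and strongly continuous and `π(f)|_W` is compact for every `f ∈ C_c(G)`,
then the closed invariant subspace `W` is discretely decomposable. [cite: DeitmarEchterhoff2014, Lemma 9.2.7] -/
theorem isDiscretelyDecomposable_toContRep_of_forall_isCompactOperator [IsTopologicalGroup G]
    [T2Space G] [LocallyCompactSpace G] (hu : π.IsUnitary) (hc : π.IsStronglyContinuous)
    (η : Measure G) [IsFiniteMeasureOnCompacts η] [η.IsOpenPosMeasure] (W : ClosedSubrep π)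
    (h_compact : ∀ f : C_c(G, ℂ), IsCompactOperator fun w : W.toSubmodule =>
      π.integratedOperator hu hc η f (w : H)) :
    W.toContRep.IsDiscretelyDecomposable :=
  W.isDiscretelyDecomposable_toContRep_of_isCompactOperator_integrated hu hc η Set.univ
    (fun _ hU => by
      obtain ⟨f, hf, hfU, hfpos⟩ := exists_dirac_function η hU
      exact ⟨f, Set.mem_univ f, hf, hfU, hfpos⟩)
    fun f _ => h_compact f

end ContRepresentation.ClosedSubrep
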